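import Summits.Schanuel.Schanuel.Theorems.SoloInformedX193Window

/-!
# X193 kernel line, file F7a: lives of the cheap servers, regrouping and the exchange step

Solo seat `solo-Schanuel-informed`, X193 kernel programme (design note
`work/s213/X193-KERNEL-DESIGN.md`, Amendment A4; pen proof `work/s194/X193-pen.md` §7;
files F2 = `SoloInformedX193Service`, F5 = `SoloInformedX193EntryFare`,
F5b = `SoloInformedX193Window`).

The count of pen §7 double-counts the incidences (column `k`, level `n`), `n` in a window
of levels `W = [N₀, N₁]`, `k ≤ K'` a column assigned at level `n` to a CHEAP capped main
server `P = srv_n k` (the conclusion of pen §6, recorded here as the hypothesis family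
`cheapAssignable`, (H6) of the design, to be proved from (Srv), (PAIR), NCD and (C) in
file F6).  This file contains the purely combinatorial part of that count for an abstract
service structure `D : SoloServiceData ι`:

* `cheapAssignable` and its unpacking over a window of levels (`cheapAssignable_choose`);
* the LIVES `(P, e)`, `e = entry P n`, met by the servers `P ∈ Srv n`, `n ∈ W` (`lives`,
  `lifeLevels`) and the regrouping identity
  `Σ_{n ∈ W} Σ_{P ∈ Srv n} f (P, entry P n, n) = Σ_{(P,e) ∈ lives} Σ_{n ∈ levels of (P,e)} f`
  (`sum_servers_eq_sum_lives`), with the supply side of the double count regrouped by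
  lives (`supply_regroup`);
* the EXCHANGE step of pen §7 ("distinct lives of one piece occupy disjoint levels"): for
  a fixed level `ℓ` the lives `(P, e)` with `e ≤ ℓ ≤ V e ≤` (a witnessing level) are
  determined by `P`, which is alive at `ℓ`; hence
  `Σ_{(P,e) ∈ lives} Σ_{ℓ ∈ [e, V e]} w (P, ℓ) ≤ Σ_ℓ Σ_{P alive at ℓ} w (P, ℓ)` for `w ≥ 0`
  (`sum_lives_window_le`), and with the budget `Σ_{P alive at ℓ} m_P(ℓ) C_P(ℓ) / ℓ^{β+2}
  ≤ (2 + b₁) / ℓ` (`level_payment_le`) and the lifetime payment of file F5b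
  (`life_payment_lower`) the bound
  `Σ_{(P,e) ∈ lives} (θ/κ^{β+1}) (g_P / e + L_P / e^β) ≤ Σ_{ℓ ∈ [A, Bm]} (2 + b₁) / ℓ`
  (`lives_cost_le_harmonic`).

No analysis beyond these inequalities; the harmonic sums, the cost-to-payment conversion
and the endgame are files F7b-F7d.  No sorries.
-/

namespace Summit.Schanuel.Schanuel.Theorems

open Finset

namespace SoloServiceData

variable {ι : Type*} (D : SoloServiceData ι)

/-! ### The budget collected at one level -/

/-- (Bud) in payment form: at a level `ℓ ≥ max n₀ 1`,
`Σ_{P alive at ℓ} m_P(ℓ) C_P(ℓ) / ℓ^{β+2} ≤ (2 + b₁) / ℓ`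
(since `Σ m_P C_P(ℓ) = ℓ^β Σ m_P g_P + ℓ Σ m_P L_P ≤ 2 ℓ^{β+1} + b₁ ℓ²` and `β ≥ 1`). -/
theorem level_payment_le {β b₁ : ℝ} {n₀ : ℕ} (hB : D ∈ budgetLaw β b₁ n₀) (hb₁ : 0 ≤ b₁)
    (hβ : 1 ≤ β) {ℓ : ℕ} (hℓ0 : n₀ ≤ ℓ) (hℓ1 : 1 ≤ ℓ) :
    ∑ P ∈ D.alive ℓ, (D.mult P ℓ : ℝ) * D.cost β P ℓ / (ℓ : ℝ) ^ (β + 2) ≤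
      (2 + b₁) / (ℓ : ℝ) := by
  have hℓpos : (0 : ℝ) < ℓ := by exact_mod_cast hℓ1
  obtain ⟨h1, h2⟩ := hB ℓ hℓ0
  have hsum : ∑ P ∈ D.alive ℓ, (D.mult P ℓ : ℝ) * D.cost β P ℓ =
      (ℓ : ℝ) ^ β * ∑ P ∈ D.alive ℓ, (D.mult P ℓ : ℝ) * D.deg P +
        (ℓ : ℝ) * ∑ P ∈ D.alive ℓ, (D.mult P ℓ : ℝ) * D.logHt P := by
    rw [Finset.mul_sum, Finset.mul_sum, ← Finset.sum_add_distrib]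
    refine Finset.sum_congr rfl fun P _ => ?_
    unfold cost
    ring
  have e1 : (ℓ : ℝ) ^ (β + 1) = (ℓ : ℝ) ^ β * ℓ := by
    rw [Real.rpow_add hℓpos, Real.rpow_one]
  have hle : ∑ P ∈ D.alive ℓ, (D.mult P ℓ : ℝ) * D.cost β P ℓ ≤
      2 * (ℓ : ℝ) ^ (β + 1) + b₁ * (ℓ : ℝ) ^ 2 := by
    rw [hsum, e1]
    have hℓβ : (0 : ℝ) ≤ (ℓ : ℝ) ^ β := by positivity
    nlinarith [mul_le_mul_of_nonneg_left h1 hℓβ, mul_le_mul_of_nonneg_left h2 hℓpos.le]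
  have hsq : (ℓ : ℝ) ^ 2 ≤ (ℓ : ℝ) ^ (β + 1) := by
    have hℓ1' : (1 : ℝ) ≤ ℓ := by exact_mod_cast hℓ1
    have := Real.rpow_le_rpow_of_exponent_le hℓ1' (by linarith : (2 : ℝ) ≤ β + 1)
    rwa [Real.rpow_two] at this
  have e2 : (ℓ : ℝ) ^ (β + 2) = (ℓ : ℝ) ^ (β + 1) * ℓ := by
    rw [show β + 2 = (β + 1) + 1 by ring, Real.rpow_add hℓpos, Real.rpow_one]
  rw [← Finset.sum_div, div_le_div_iff₀ (Real.rpow_pos_of_pos hℓpos _) hℓpos, e2]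
  have hℓβ1 : (0 : ℝ) ≤ (ℓ : ℝ) ^ (β + 1) := by positivity
  nlinarith [mul_le_mul_of_nonneg_right hle hℓpos.le, mul_le_mul_of_nonneg_left hsq hb₁,
    mul_nonneg hb₁ hℓβ1]

section Lives

variable [DecidableEq ι]

/-! ### (H6) the cheap-assignment hypothesis -/

/-- (H6) cheap assignment (the conclusion of pen §6, DESIGN A4): at every level `n ≥ n₆`
and for every `K ≤ n^σ`, all but at most `A₆ n^{σ-γ}` of the columns `1 ≤ k ≤ K` are
assigned to a main server `srv k`, alive at `n`, with `λ n^ν ≤ m d^k`, capped bank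
`d^k ≤ cap_n`, and CHEAP with respect to its fibre:
`m C(n) ≤ η n^ν · #{k' assigned : srv k' = srv k}` (fare `≤ η`). -/
def cheapAssignable (lam η σ γ ν β B A₆ : ℝ) (n₆ : ℕ) : Set (SoloServiceData ι) :=
  {D | ∀ n : ℕ, n₆ ≤ n → ∀ K : ℕ, (K : ℝ) ≤ (n : ℝ) ^ σ →
    ∃ Exc : Finset ℕ, ∃ srv : ℕ → ι,
      (Exc.card : ℝ) ≤ A₆ * (n : ℝ) ^ (σ - γ) ∧
      ∀ k ∈ Finset.Icc 1 K \ Exc,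
        srv k ∈ D.alive n ∧
        lam * (n : ℝ) ^ ν ≤ D.mult (srv k) n * D.bank (srv k) k ∧
        D.bank (srv k) k ≤ D.cap B (srv k) n ∧
        (D.mult (srv k) n : ℝ) * D.cost β (srv k) n ≤
          η * (n : ℝ) ^ ν * ((Finset.Icc 1 K \ Exc).filter (fun k' => srv k' = srv k)).card}

/-- Unpacking (H6) on a set of levels `W` (all `≥ n₆`, with `K ≤ n^σ` on `W`): good columns
`G n ⊆ [1, K]` with `|G n| ≥ K - A₆ n^{σ-γ}` and servers `srv n k`, as total functions of
the level. -/
theorem cheapAssignable_choose {lam η σ γ ν β B A₆ : ℝ} {n₆ : ℕ}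
    (h6 : D ∈ cheapAssignable lam η σ γ ν β B A₆ n₆) (W : Finset ℕ) (K : ℕ)
    (hW6 : ∀ n ∈ W, n₆ ≤ n) (hK : ∀ n ∈ W, (K : ℝ) ≤ (n : ℝ) ^ σ) :
    ∃ G : ℕ → Finset ℕ, ∃ srv : ℕ → ℕ → ι, ∀ n ∈ W,
      G n ⊆ Finset.Icc 1 K ∧ (K : ℝ) - A₆ * (n : ℝ) ^ (σ - γ) ≤ (G n).card ∧
      ∀ k ∈ G n, srv n k ∈ D.alive n ∧
        lam * (n : ℝ) ^ ν ≤ D.mult (srv n k) n * D.bank (srv n k) k ∧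
        D.bank (srv n k) k ≤ D.cap B (srv n k) n ∧
        (D.mult (srv n k) n : ℝ) * D.cost β (srv n k) n ≤
          η * (n : ℝ) ^ ν * ((G n).filter (fun k' => srv n k' = srv n k)).card := by
  have h : ∀ n : ℕ, ∃ Exc : Finset ℕ, ∃ srv : ℕ → ι, n ∈ W →
      ((Exc.card : ℝ) ≤ A₆ * (n : ℝ) ^ (σ - γ) ∧
      ∀ k ∈ Finset.Icc 1 K \ Exc,
        srv k ∈ D.alive n ∧
        lam * (n : ℝ) ^ ν ≤ D.mult (srv k) n * D.bank (srv k) k ∧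
        D.bank (srv k) k ≤ D.cap B (srv k) n ∧
        (D.mult (srv k) n : ℝ) * D.cost β (srv k) n ≤
          η * (n : ℝ) ^ ν *
            ((Finset.Icc 1 K \ Exc).filter (fun k' => srv k' = srv k)).card) := by
    intro n
    by_cases hn : n ∈ W
    · obtain ⟨Exc, srv, h1, h2⟩ := h6 n (hW6 n hn) K (hK n hn)
      exact ⟨Exc, srv, fun _ => ⟨h1, h2⟩⟩
    · obtain ⟨Exc, srv, -, -⟩ := h6 n₆ le_rfl 0 (by rw [Nat.cast_zero]; positivity)
      exact ⟨Exc, srv, fun h => absurd h hn⟩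
  choose Exc srv hspec using h
  refine ⟨fun n => Finset.Icc 1 K \ Exc n, srv, fun n hn => ?_⟩
  obtain ⟨h1, h2⟩ := hspec n hn
  refine ⟨Finset.sdiff_subset, ?_, fun k hk => h2 k hk⟩
  have hc : (Finset.Icc 1 K).card ≤ (Finset.Icc 1 K \ Exc n).card + (Exc n).card :=
    Finset.card_le_card_sdiff_add_card
  rw [Nat.card_Icc, Nat.add_sub_cancel] at hc
  have hc' : (K : ℝ) ≤ ((Finset.Icc 1 K \ Exc n).card : ℝ) + (Exc n).card := by
    exact_mod_cast hc
  linarith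

/-! ### Lives and the regrouping identity -/

/-- The LIVES met by the server sets `Srv n`, `n ∈ W`: the pairs `(P, entry P n)` with
`n ∈ W` and `P ∈ Srv n` (a life of a piece = a maximal interval of levels where it is
alive; it is named by its entry level). -/
noncomputable def lives (W : Finset ℕ) (Srv : ℕ → Finset ι) : Finset (ι × ℕ) :=
  W.biUnion fun n => (Srv n).image fun P => (P, D.entry P n)

/-- Membership in `lives`. -/
theorem mem_lives {W : Finset ℕ} {Srv : ℕ → Finset ι} {pe : ι × ℕ} :
    pe ∈ D.lives W Srv ↔ ∃ n ∈ W, pe.1 ∈ Srv n ∧ D.entry pe.1 n = pe.2 := by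
  unfold lives
  simp only [Finset.mem_biUnion, Finset.mem_image]
  constructor
  · rintro ⟨n, hn, P, hP, rfl⟩
    exact ⟨n, hn, hP, rfl⟩
  · rintro ⟨n, hn, hP, he⟩
    exact ⟨n, hn, pe.1, hP, Prod.ext rfl he⟩

/-- The life of a server at a level of `W` is listed in `lives`. -/
theorem mk_mem_lives {W : Finset ℕ} {Srv : ℕ → Finset ι} {n : ℕ} (hn : n ∈ W) {P : ι}
    (hP : P ∈ Srv n) : (P, D.entry P n) ∈ D.lives W Srv :=
  D.mem_lives.mpr ⟨n, hn, hP, rfl⟩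

/-- The levels of `W` at which the life `(P, e)` serves: `P ∈ Srv n` and `entry P n = e`. -/
noncomputable def lifeLevels (W : Finset ℕ) (Srv : ℕ → Finset ι) (P : ι) (e : ℕ) : Finset ℕ :=
  W.filter fun n => P ∈ Srv n ∧ D.entry P n = e

/-- Membership in `lifeLevels`. -/
theorem mem_lifeLevels {W : Finset ℕ} {Srv : ℕ → Finset ι} {P : ι} {e n : ℕ} :
    n ∈ D.lifeLevels W Srv P e ↔ n ∈ W ∧ P ∈ Srv n ∧ D.entry P n = e := by
  simp [lifeLevels]

/-- `lifeLevels ⊆ W`. -/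
theorem lifeLevels_subset (W : Finset ℕ) (Srv : ℕ → Finset ι) (P : ι) (e : ℕ) :
    D.lifeLevels W Srv P e ⊆ W :=
  Finset.filter_subset _ _

/-- REGROUPING BY LIVES (pen §7, supply side): a sum over the levels `n ∈ W` and the
servers `P ∈ Srv n` of a quantity depending on `P`, its entry level and `n` is the sum
over the lives `(P, e)` of the sum over the levels of that life. -/
theorem sum_servers_eq_sum_lives (W : Finset ℕ) (Srv : ℕ → Finset ι)
    (f : ι → ℕ → ℕ → ℝ) :
    ∑ n ∈ W, ∑ P ∈ Srv n, f P (D.entry P n) n =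
      ∑ pe ∈ D.lives W Srv, ∑ n ∈ D.lifeLevels W Srv pe.1 pe.2, f pe.1 pe.2 n := by
  have hinj : ∀ n : ℕ, Set.InjOn (fun P : ι => (P, D.entry P n)) (Srv n : Set ι) := by
    intro n P _ Q _ h
    exact (Prod.ext_iff.mp h).1
  have h1 : ∀ n ∈ W, ∑ P ∈ Srv n, f P (D.entry P n) n =
      ∑ pe ∈ (Srv n).image (fun P => (P, D.entry P n)), f pe.1 pe.2 n := by
    intro n _
    rw [Finset.sum_image (hinj n)]
  rw [Finset.sum_congr rfl h1]
  refine Finset.sum_comm' fun n pe => ?_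
  simp only [Finset.mem_image, mem_lifeLevels, mem_lives]
  constructor
  · rintro ⟨hn, P, hP, rfl⟩
    exact ⟨⟨hn, hP, rfl⟩, n, hn, hP, rfl⟩
  · rintro ⟨⟨hn, hP, he⟩, _⟩
    exact ⟨hn, pe.1, hP, Prod.ext rfl he⟩

/-- SUPPLY, regrouped (pen §7): if at each level `n ∈ W` the good columns `G n` are
assigned by `srv n` and the fibre of every server `P` has at most `s (P, entry P n)`
columns (the per-level supply bound of pen §5 (b'), a function of the life only), then
`Σ_{n ∈ W} |G n| / n ≤ Σ_{(P,e) ∈ lives} s (P, e) · Σ_{n ∈ levels of (P,e)} 1 / n`. -/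
theorem supply_regroup (W : Finset ℕ) (G : ℕ → Finset ℕ) (srv : ℕ → ℕ → ι)
    (s : ι → ℕ → ℝ)
    (hs : ∀ n ∈ W, ∀ P ∈ (G n).image (srv n),
      (((G n).filter (fun k => srv n k = P)).card : ℝ) ≤ s P (D.entry P n)) :
    ∑ n ∈ W, ((G n).card : ℝ) / n ≤
      ∑ pe ∈ D.lives W (fun n => (G n).image (srv n)),
        s pe.1 pe.2 *
          ∑ n ∈ D.lifeLevels W (fun n => (G n).image (srv n)) pe.1 pe.2, 1 / (n : ℝ) := by
  have h1 : ∀ n ∈ W, ((G n).card : ℝ) / n =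
      ∑ P ∈ (G n).image (srv n), (((G n).filter (fun k => srv n k = P)).card : ℝ) / n := by
    intro n _
    rw [Finset.card_eq_sum_card_image (srv n) (G n)]
    push_cast
    rw [Finset.sum_div]
  rw [Finset.sum_congr rfl h1]
  have h2 : ∑ n ∈ W, ∑ P ∈ (G n).image (srv n),
      (((G n).filter (fun k => srv n k = P)).card : ℝ) / n ≤
      ∑ n ∈ W, ∑ P ∈ (G n).image (srv n), s P (D.entry P n) / n := by
    apply Finset.sum_le_sum
    intro n hn
    apply Finset.sum_le_sum
    intro P hP
    exact div_le_div_of_nonneg_right (hs n hn P hP) (by positivity)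
  refine h2.trans (le_of_eq ?_)
  rw [D.sum_servers_eq_sum_lives W (fun n => (G n).image (srv n)) (fun P e n => s P e / n)]
  refine Finset.sum_congr rfl fun pe _ => ?_
  rw [Finset.mul_sum]
  refine Finset.sum_congr rfl fun n _ => ?_
  ring

/-! ### The exchange step -/

/-- A listed life keeps its name on its window: if `(P, e) ∈ lives` and `V e ≤` every
witnessing level, then for `e ≤ ℓ ≤ V e` the entry level of `P` at `ℓ` is `e` and `P` is
alive at `ℓ` (monotonicity of lives, file F2). -/
theorem entry_eq_of_mem_lives {W : Finset ℕ} {Srv : ℕ → Finset ι} {V : ℕ → ℕ}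
    (hV : ∀ n ∈ W, ∀ P ∈ Srv n, V (D.entry P n) ≤ n) {pe : ι × ℕ}
    (hpe : pe ∈ D.lives W Srv) {ℓ : ℕ} (h1 : pe.2 ≤ ℓ) (h2 : ℓ ≤ V pe.2) :
    D.entry pe.1 ℓ = pe.2 ∧ pe.1 ∈ D.alive ℓ := by
  obtain ⟨n, hn, hP, he⟩ := D.mem_lives.mp hpe
  have hVn : V pe.2 ≤ n := by rw [← he]; exact hV n hn pe.1 hP
  have hℓn : ℓ ≤ n := h2.trans hVn
  have h1' : D.entry pe.1 n ≤ ℓ := by rw [he]; exact h1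
  exact ⟨(D.entry_eq_of_mem_life pe.1 n ℓ h1' hℓn).trans he,
    D.alive_of_entry_le pe.1 n ℓ h1' hℓn⟩

/-- EXCHANGE (pen §7: "distinct lives of one piece occupy disjoint levels"): for weights
`w ≥ 0`, windows `[e, V e]` with `V e ≤` every witnessing level, entries `≥ A` and levels
`≤ Bm` on `W`,
`Σ_{(P,e) ∈ lives} Σ_{ℓ ∈ [e, V e]} w (P, ℓ) ≤ Σ_{ℓ ∈ [A, Bm]} Σ_{P alive at ℓ} w (P, ℓ)`:
for fixed `ℓ` the map `(P, e) ↦ P` is injective on the lives whose window contains `ℓ`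
(`e = entry P ℓ`), with image in the pieces alive at `ℓ`. -/
theorem sum_lives_window_le (W : Finset ℕ) (Srv : ℕ → Finset ι) (V : ℕ → ℕ) (A Bm : ℕ)
    (hV : ∀ n ∈ W, ∀ P ∈ Srv n, V (D.entry P n) ≤ n)
    (hA : ∀ n ∈ W, ∀ P ∈ Srv n, A ≤ D.entry P n) (hBm : ∀ n ∈ W, n ≤ Bm)
    (w : ι → ℕ → ℝ) (hw : ∀ P ℓ, 0 ≤ w P ℓ) :
    ∑ pe ∈ D.lives W Srv, ∑ ℓ ∈ Finset.Icc pe.2 (V pe.2), w pe.1 ℓ ≤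
      ∑ ℓ ∈ Finset.Icc A Bm, ∑ P ∈ D.alive ℓ, w P ℓ := by
  have hex : ∑ pe ∈ D.lives W Srv, ∑ ℓ ∈ Finset.Icc pe.2 (V pe.2), w pe.1 ℓ =
      ∑ ℓ ∈ Finset.Icc A Bm,
        ∑ pe ∈ (D.lives W Srv).filter (fun pe => pe.2 ≤ ℓ ∧ ℓ ≤ V pe.2), w pe.1 ℓ := by
    refine Finset.sum_comm' fun pe ℓ => ?_
    simp only [Finset.mem_Icc, Finset.mem_filter]
    constructor
    · rintro ⟨hpe, h1, h2⟩
      obtain ⟨n, hn, hP, he⟩ := D.mem_lives.mp hpe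
      have hAe : A ≤ pe.2 := by rw [← he]; exact hA n hn pe.1 hP
      have hVn : V pe.2 ≤ n := by rw [← he]; exact hV n hn pe.1 hP
      exact ⟨⟨hpe, h1, h2⟩, hAe.trans h1, h2.trans (hVn.trans (hBm n hn))⟩
    · rintro ⟨⟨hpe, h1, h2⟩, -, -⟩
      exact ⟨hpe, h1, h2⟩
  rw [hex]
  apply Finset.sum_le_sum
  intro ℓ _
  set F := (D.lives W Srv).filter (fun pe => pe.2 ≤ ℓ ∧ ℓ ≤ V pe.2) with hF
  have hkey : ∀ pe ∈ F, D.entry pe.1 ℓ = pe.2 ∧ pe.1 ∈ D.alive ℓ := by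
    intro pe hpe
    rw [hF, Finset.mem_filter] at hpe
    exact D.entry_eq_of_mem_lives hV hpe.1 hpe.2.1 hpe.2.2
  have hinj : Set.InjOn Prod.fst (F : Set (ι × ℕ)) := by
    intro pe hpe pe' hpe' h
    have e1 := (hkey pe (Finset.mem_coe.mp hpe)).1
    have e2 := (hkey pe' (Finset.mem_coe.mp hpe')).1
    refine Prod.ext h ?_
    rw [← e1, ← e2]
    exact congrArg (fun P => D.entry P ℓ) h
  have himg : F.image Prod.fst ⊆ D.alive ℓ := by
    intro P hP
    rw [Finset.mem_image] at hP
    obtain ⟨pe, hpe, rfl⟩ := hP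
    exact (hkey pe hpe).2
  calc ∑ pe ∈ F, w pe.1 ℓ = ∑ P ∈ F.image Prod.fst, w P ℓ :=
        (Finset.sum_image (f := fun P => w P ℓ) hinj).symm
    _ ≤ ∑ P ∈ D.alive ℓ, w P ℓ :=
        Finset.sum_le_sum_of_subset_of_nonneg himg fun P _ _ => hw P ℓ

/-- EXCHANGE + (Bud): with entries `≥ A ≥ max n₀ 1` and levels `≤ Bm` on `W`,
`Σ_{(P,e) ∈ lives} Σ_{ℓ ∈ [e, V e]} m_P(ℓ) C_P(ℓ) / ℓ^{β+2} ≤ Σ_{ℓ ∈ [A, Bm]} (2 + b₁) / ℓ`. -/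
theorem lives_payment_le {c₀ β b₁ : ℝ} {n₀ : ℕ} (hW : D ∈ wellFormed c₀)
    (hB : D ∈ budgetLaw β b₁ n₀) (hb₁ : 0 ≤ b₁) (hβ : 1 ≤ β) (W : Finset ℕ)
    (Srv : ℕ → Finset ι) (V : ℕ → ℕ) (A Bm : ℕ) (hA0 : n₀ ≤ A) (hA1 : 1 ≤ A)
    (hV : ∀ n ∈ W, ∀ P ∈ Srv n, V (D.entry P n) ≤ n)
    (hA : ∀ n ∈ W, ∀ P ∈ Srv n, A ≤ D.entry P n) (hBm : ∀ n ∈ W, n ≤ Bm) :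
    ∑ pe ∈ D.lives W Srv, ∑ ℓ ∈ Finset.Icc pe.2 (V pe.2),
        (D.mult pe.1 ℓ : ℝ) * D.cost β pe.1 ℓ / (ℓ : ℝ) ^ (β + 2) ≤
      ∑ ℓ ∈ Finset.Icc A Bm, (2 + b₁) / (ℓ : ℝ) := by
  have hw : ∀ (P : ι) (ℓ : ℕ), 0 ≤ (D.mult P ℓ : ℝ) * D.cost β P ℓ / (ℓ : ℝ) ^ (β + 2) := by
    intro P ℓ
    have hc : 0 ≤ D.cost β P ℓ :=
      le_trans (Real.rpow_nonneg (Nat.cast_nonneg ℓ) β) (D.rpow_le_cost hW β P ℓ)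
    exact div_nonneg (mul_nonneg (Nat.cast_nonneg _) hc)
      (Real.rpow_nonneg (Nat.cast_nonneg _) _)
  refine (D.sum_lives_window_le W Srv V A Bm hV hA hBm
    (fun P ℓ => (D.mult P ℓ : ℝ) * D.cost β P ℓ / (ℓ : ℝ) ^ (β + 2)) hw).trans ?_
  apply Finset.sum_le_sum
  intro ℓ hℓ
  rw [Finset.mem_Icc] at hℓ
  exact D.level_payment_le hB hb₁ hβ (hA0.trans hℓ.1) (hA1.trans hℓ.1)

/-! ### The lifetime payment of a listed life -/

/-- The payment collected by one listed life (file F5b `payment_lower` and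
`soloX_window_payment`, rewritten in terms of the life `(P, e)`): if every server met on
`W` has entry `e ≥ 1`, window `[e, V e]` inside its life up to the witnessing level,
`θ e ≤ V e + 1 - e` and `V e ≤ κ e`, then
`(θ / κ^{β+1}) (g_P / e + L_P / e^β) ≤ Σ_{ℓ ∈ [e, V e]} m_P(ℓ) C_P(ℓ) / ℓ^{β+2}`. -/
theorem life_payment_lower {c₀ β : ℝ} (hW : D ∈ wellFormed c₀) (hβ : 1 ≤ β)
    {W : Finset ℕ} {Srv : ℕ → Finset ι} {V : ℕ → ℕ} {θ κ : ℝ} (hθ : 0 ≤ θ) (hκ : 1 ≤ κ)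
    (hlife : ∀ n ∈ W, ∀ P ∈ Srv n,
      1 ≤ D.entry P n ∧ D.entry P n ≤ V (D.entry P n) ∧ V (D.entry P n) ≤ n ∧
      θ * (D.entry P n : ℝ) ≤ (V (D.entry P n) : ℝ) + 1 - D.entry P n ∧
      (V (D.entry P n) : ℝ) ≤ κ * D.entry P n)
    {pe : ι × ℕ} (hpe : pe ∈ D.lives W Srv) :
    θ / κ ^ (β + 1) * ((D.deg pe.1 : ℝ) / pe.2 + D.logHt pe.1 / (pe.2 : ℝ) ^ β) ≤
      ∑ ℓ ∈ Finset.Icc pe.2 (V pe.2),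
        (D.mult pe.1 ℓ : ℝ) * D.cost β pe.1 ℓ / (ℓ : ℝ) ^ (β + 2) := by
  obtain ⟨n, hn, hP, he⟩ := D.mem_lives.mp hpe
  obtain ⟨he1, heV, hVn, hwin, hVκ⟩ := hlife n hn pe.1 hP
  have hpl := D.payment_lower hW (le_trans zero_le_one hβ) he1 heV hVn
  rw [he] at hpl he1 heV hwin hVκ
  have he0 : (0 : ℝ) < (pe.2 : ℝ) := by exact_mod_cast he1
  have hV0 : (0 : ℝ) < (V pe.2 : ℝ) := by exact_mod_cast (le_trans he1 heV)
  have hg : (0 : ℝ) ≤ D.deg pe.1 := by positivity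
  have hL : 0 ≤ D.logHt pe.1 := hW.2.1 pe.1
  exact (soloX_window_payment hβ hg hL he0 hV0 hθ hκ hwin hVκ).trans hpl

/-- PAYMENT side of pen §7 assembled: under the hypotheses of `life_payment_lower` and with
entries `≥ A ≥ max n₀ 1`, levels `≤ Bm` on `W`,
`Σ_{(P,e) ∈ lives} (θ / κ^{β+1}) (g_P / e + L_P / e^β) ≤ Σ_{ℓ ∈ [A, Bm]} (2 + b₁) / ℓ`
("`Σ_{(P,life)} Π_P ≤ (2 + o) Σ_ℓ 1/ℓ`"). -/
theorem lives_cost_le_harmonic {c₀ β b₁ : ℝ} {n₀ : ℕ} (hW : D ∈ wellFormed c₀)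
    (hB : D ∈ budgetLaw β b₁ n₀) (hb₁ : 0 ≤ b₁) (hβ : 1 ≤ β) (W : Finset ℕ)
    (Srv : ℕ → Finset ι) (V : ℕ → ℕ) (A Bm : ℕ) (hA0 : n₀ ≤ A) (hA1 : 1 ≤ A)
    {θ κ : ℝ} (hθ : 0 ≤ θ) (hκ : 1 ≤ κ)
    (hlife : ∀ n ∈ W, ∀ P ∈ Srv n,
      1 ≤ D.entry P n ∧ D.entry P n ≤ V (D.entry P n) ∧ V (D.entry P n) ≤ n ∧
      θ * (D.entry P n : ℝ) ≤ (V (D.entry P n) : ℝ) + 1 - D.entry P n ∧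
      (V (D.entry P n) : ℝ) ≤ κ * D.entry P n)
    (hA : ∀ n ∈ W, ∀ P ∈ Srv n, A ≤ D.entry P n) (hBm : ∀ n ∈ W, n ≤ Bm) :
    ∑ pe ∈ D.lives W Srv,
        θ / κ ^ (β + 1) * ((D.deg pe.1 : ℝ) / pe.2 + D.logHt pe.1 / (pe.2 : ℝ) ^ β) ≤
      ∑ ℓ ∈ Finset.Icc A Bm, (2 + b₁) / (ℓ : ℝ) := by
  have hV : ∀ n ∈ W, ∀ P ∈ Srv n, V (D.entry P n) ≤ n :=
    fun n hn P hP => (hlife n hn P hP).2.2.1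
  exact (Finset.sum_le_sum fun pe hpe => D.life_payment_lower hW hβ hθ hκ hlife hpe).trans
    (D.lives_payment_le hW hB hb₁ hβ W Srv V A Bm hA0 hA1 hV hA hBm)

end Lives

end SoloServiceData

end Summit.Schanuel.Schanuel.Theorems
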